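import Literature.MathematicalPhysics.QuantumFieldTheory.Balaban1983to89.B5G183RateWTheta

/-!
# Bałaban [CMP 95 (1984)] (1.83)/(1.89) at `U = 1`, order two: the FOUR FINITE-RANK PIECES of the
eta-rate keep the full rate `1/N` for EVERY pair of weights dominated by the lattice derivative

HONEST FRAMING (cell `pub-balaban`, T⁴ programme, estimate NE2 = U1a «η-rate, linear theory»).  Finite
torus, lattice spacing `η = 1/n`, trivial background `U = 1`, one nonzero reduced momentum `p′ = s` at a
time, `ℓ²`-operator norm on the alias classes `× Fin d`.  Nothing here is about infinite volume, `U ≠ 1`,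
a mass gap, or any summit statement.  Bałaban prints NO rate; the currency, King's pairing `ι`/`plant`
and every constant are OURS ([folklore]).

WHAT IS PRINTED.  [Balaban1984PropagatorsI] p. 31 (1.83): `G(p′)` = free diagonal `δδ/Δ(p′+l)` minus the
x-blocks `a Σ_μ φ_μ⁻¹ x_μ ⊗ x̄_μ` plus the rank-one bracket term; p. 33: «Proposition 1.1. The operator G
is a symmetric operator on L²(T_η) and ‖GJ‖, ‖∇GJ‖, ‖G∇*J‖, ‖∇G∇*J‖, ‖∇∇GJ‖, ‖G∇*∇*J‖ ≤ γ₀⁻¹‖J‖, (1.89)».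
[King1986] p. 672: «To analyze the m = 0 term in (4.19), we successively replace each factor by the
corresponding one … and bound the error.», (4.20) `|u(p′+l)| ≤ Π_μ |p′_μ||p′_μ + l_μ|⁻¹`, (4.23) «≤ CL^{−γk}
for α + γ < 1»; p. 673: «So keeping γ + α < 1, the error produced by the above replacement is bounded by
CL^{−γk}.»  (renders ref1 p015–p017, king p024/p025 read as images by this lineage.)

WHAT THIS MODULE PROVES (kernel, [folklore]).  The finite-rank half of the five-piece route
(`B5G183RatePieces.residual_eq_pieces`) with the WEIGHTS ABSTRACTED: for any weight data
`wR : classes(RN) → ℂ`, `wN : classes(N) → ℂ` in direction `ν` that are DOMINATED by the derivative symbol,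
`|wR(K)| ≤ |∂^{(RN)}_ν(q̃_K)|`, `|wN(k)| ≤ |∂^{(N)}_ν(q̃_k)|`, and have the PAIRED eta-rate
`|wR(ιk) − wN(k)| ≤ 6‖q̃_k‖²/N` (`AdmW`; met by `∂`, by King's `W∂` and by every real power `W^θ∂`,
`θ ≥ 0` — §7), the four finite-rank piece differences of Bałaban's fibres between the levels obey the SAME
bounds as in the `W∂ ⊗ W∂` case, with the SAME constants:
 §3 **`opNorm_R_piece_le_of_adm`** `≤ CRW1(d,a)/N` (x-block `R`; `B5G183RateW1BlockR` with the weight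
    abstracted), §4 **`opNorm_C1_piece_le_of_adm`**, **`opNorm_C2_piece_le_of_adm`** `≤ CCW1(d,a)/N`
    (centre x-blocks; `B5G183RateW1BlockC`), §5 **`opNorm_T_piece_le_of_adm`** `≤ CTW1(d,a)/N` (rank one;
    `B5G183RateW1RankOne`), §6 **`residual_le_diag_add_of_adm`**: the planted level difference of the
    sandwich `D_{wR} F_{RN} D*_{wR′} − plant_R(D_{wN} F_N D*_{wN′})` is `≤ ‖diagonal piece‖ +
    (CRW1 + 2·CCW1 + CTW1)/N`.  §7: the weights `W^θ∂` of `B5G183RateWTheta` are admissible for every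
    `θ ≥ 0` (`admW_wθ`), so the EXPONENT TRADE of `OrderTwoOpRateResidualWθ` lives on the free diagonal
    alone (`residualWθ_le_diag_add`).
The proofs are those of the three `W1` modules nearly verbatim; only the two weight facts they used
(`|W∂| ≤ |∂|`, paired rate `6‖q̃‖²/N`) are turned into hypotheses.

NOT CLAIMED: any bound on the diagonal piece for `θ < 1` (successor module); `p′`-derivatives; the
`∫dp′` identification; Prop. 1.2 decay with rate; `U ≠ 1`; constants.
-/

noncomputable section

namespace Literature.MathematicalPhysics.QuantumFieldTheory.Balaban1983to89.B5G183RateWgtPieces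

open scoped BigOperators ComplexConjugate Matrix.Norms.L2Operator
open Finset Complex
open Literature.MathematicalPhysics.QuantumFieldTheory.Balaban1983to89.B4Strip
open Literature.MathematicalPhysics.QuantumFieldTheory.Balaban1983to89.B5Prop11Leaves
open Literature.MathematicalPhysics.QuantumFieldTheory.Balaban1983to89.B5Prop11Fiber
open Literature.MathematicalPhysics.QuantumFieldTheory.Balaban1983to89.B5Prop11Bound
open Literature.MathematicalPhysics.QuantumFieldTheory.Balaban1983to89.B5Hk163Rate
open Literature.MathematicalPhysics.QuantumFieldTheory.Balaban1983to89.B5Hk163RateSum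
open Literature.MathematicalPhysics.QuantumFieldTheory.Balaban1983to89.B5G183Rate
open Literature.MathematicalPhysics.QuantumFieldTheory.Balaban1983to89.B5G183RateSum
open Literature.MathematicalPhysics.QuantumFieldTheory.Balaban1983to89.B5G183RateL2
open Literature.MathematicalPhysics.QuantumFieldTheory.Balaban1983to89.B5G183RateOp
open Literature.MathematicalPhysics.QuantumFieldTheory.Balaban1983to89.B5G183RateO2Diag
open Literature.MathematicalPhysics.QuantumFieldTheory.Balaban1983to89.B5G183RateO2Op
open Literature.MathematicalPhysics.QuantumFieldTheory.Balaban1983to89.B5G183RatePieces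
open Literature.MathematicalPhysics.QuantumFieldTheory.Balaban1983to89.B5G183RateW1Diag
open Literature.MathematicalPhysics.QuantumFieldTheory.Balaban1983to89.B5G183RateW1BlockR
open Literature.MathematicalPhysics.QuantumFieldTheory.Balaban1983to89.B5G183RateW1BlockC
open Literature.MathematicalPhysics.QuantumFieldTheory.Balaban1983to89.B5G183RateW1RankOne
open Literature.MathematicalPhysics.QuantumFieldTheory.Balaban1983to89.B5G183RateWTheta
open Literature.MathematicalPhysics.QuantumFieldTheory.King1986

variable {d : ℕ}

/-! ## §1 Weights dominated by the derivative symbol, one level [folklore] -/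

section LevelN

variable {n : ℕ} [NeZero n]

/-- a dominated weight has derivative order one: `|w(k)|² ≤ |∂_ν(q̃_k)|² ≤ Δ(p′ + k)`. [folklore] -/
theorem norm_sq_le_Delta_of_dom (hn : 1 ≤ n) (a : ℝ) (ha : 0 < a) {s : Fin d → ℝ}
    (hs : ∀ ν, |s ν| ≤ Real.pi) (hs0 : s ≠ 0) {ν : Fin d} {w : (Fin d → Fin n) → ℂ}
    (hw : ∀ K, ‖w K‖ ≤ ‖dSym n K s ν‖) (k : Fin d → Fin n) :
    ‖w k‖ ^ 2 ≤ (balabanFiber n hn a ha s hs hs0).Δ k ^ 1 :=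
  calc ‖w k‖ ^ 2 ≤ ‖dSym n k s ν‖ ^ 2 := pow_le_pow_left₀ (norm_nonneg _) (hw k) 2
    _ ≤ DeltaXir n 0 (shiftr n k s) ^ 1 := weight_order_one n s ν k
    _ = _ := rfl

/-- **two dominated weights are admissible for b05** (`Fiber.Wt`, orders `1 + 1 ≤ 2`). [folklore] -/
theorem wt_of_dom (hn : 1 ≤ n) (a : ℝ) (ha : 0 < a) {s : Fin d → ℝ} (hs : ∀ ν, |s ν| ≤ Real.pi)
    (hs0 : s ≠ 0) {ν ν' : Fin d} {wa wb : (Fin d → Fin n) → ℂ}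
    (hwa : ∀ K, ‖wa K‖ ≤ ‖dSym n K s ν‖) (hwb : ∀ K, ‖wb K‖ ≤ ‖dSym n K s ν'‖) :
    (balabanFiber n hn a ha s hs hs0).Wt wa wb :=
  (balabanFiber n hn a ha s hs hs0).Wt_of_orders (j₁ := 1) (j₂ := 1) (by norm_num)
    (norm_sq_le_Delta_of_dom hn a ha hs hs0 hwa) (norm_sq_le_Delta_of_dom hn a ha hs hs0 hwb)

/-- `|(wx_μ)′|₂ ≤ 1` for a dominated weight (b05 `Fiber.l2n_xw_le_one`). [folklore] -/
theorem l2n_xw_le_one_of_dom (hn : 1 ≤ n) (a : ℝ) (ha : 0 < a) {s : Fin d → ℝ}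
    (hs : ∀ ν, |s ν| ≤ Real.pi) (hs0 : s ≠ 0) {ν : Fin d} {w : (Fin d → Fin n) → ℂ}
    (hw : ∀ K, ‖w K‖ ≤ ‖dSym n K s ν‖) (μ : Fin d) :
    l2n ((balabanFiber n hn a ha s hs hs0).xw w μ) ≤ 1 :=
  (balabanFiber n hn a ha s hs hs0).l2n_xw_le_one (wt_of_dom hn a ha hs hs0 hw hw).left_le μ

omit [NeZero n] in
/-- a dominated weight is dominated by the momentum: `|w(k)| ≤ ‖q̃_k‖_∞` (`B5G183RateL2.norm_dSym_le`).
[folklore] -/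
theorem norm_le_alias_of_dom (hn : 1 ≤ n) {s : Fin d → ℝ} {ν : Fin d} {w : (Fin d → Fin n) → ℂ}
    (hw : ∀ K, ‖w K‖ ≤ ‖dSym n K s ν‖) (K : Fin d → Fin n) : ‖w K‖ ≤ ‖symmAlias n K s‖ :=
  (hw K).trans (B5G183RateL2.norm_dSym_le hn K s ν)

/-- at the centre a dominated weight is `≤ π` (`|∂_ν(p′)| ≤ ‖p′‖ ≤ π`). [folklore] -/
theorem norm_centre_le_pi_of_dom (hn : 1 ≤ n) {s : Fin d → ℝ} (hs : ∀ ν, |s ν| ≤ Real.pi)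
    {ν : Fin d} {w : (Fin d → Fin n) → ℂ} (hw : ∀ K, ‖w K‖ ≤ ‖dSym n K s ν‖) :
    ‖w 0‖ ≤ Real.pi := by
  have h := norm_le_alias_of_dom hn hw 0
  rw [symmAlias_zero hn hs] at h
  exact h.trans (norm_le_pi hs)

end LevelN

section TwoLevels

variable {n m : ℕ} [NeZero n] [NeZero m]

/-- **centre size, any two levels, dominated weight:** `aφ^{(n)}_μ(p′)⁻¹ · |(w x_μ)°^{(m)}|₂ ≤ π·Cc(d)`
(`|w(0)| ≤ π`, `|xP^{(m)}(p′)| ≤ D(p′)`, `B5G183RateW1BlockC.coef_Dq_le`). [cite: Balaban1984PropagatorsI,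
(1.85) p.32] [folklore] -/
theorem centre_size_le_of_dom (hn : 1 ≤ n) (hm : 1 ≤ m) (a : ℝ) (ha : 0 < a) {s : Fin d → ℝ}
    (hs : ∀ ν, |s ν| ≤ Real.pi) (hs0 : s ≠ 0) {ν : Fin d} {w : (Fin d → Fin m) → ℂ}
    (hw : ∀ K, ‖w K‖ ≤ ‖dSym m K s ν‖) (μ : Fin d) :
    a / (balabanFiber n hn a ha s hs hs0).φ μ * l2n ((balabanFiber m hm a ha s hs hs0).xo w μ)
      ≤ Real.pi * Cc d := by
  rw [l2n_xo_eq hm a ha hs hs0]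
  have hw0 := norm_centre_le_pi_of_dom hm hs hw
  have hx := norm_xP_le_Dq hm hs hs0 μ
  have hφ := (balabanFiber n hn a ha s hs hs0).φ_pos μ
  have hc := coef_Dq_le hn a ha hs hs0 μ
  have h0 : 0 ≤ a / (balabanFiber n hn a ha s hs hs0).φ μ := div_nonneg ha.le hφ.le
  calc a / (balabanFiber n hn a ha s hs hs0).φ μ * (‖w 0‖ * ‖xP m μ s‖)
      ≤ a / (balabanFiber n hn a ha s hs hs0).φ μ * (Real.pi * Dq s) :=
        mul_le_mul_of_nonneg_left (mul_le_mul hw0 hx (norm_nonneg _) Real.pi_pos.le) h0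
    _ = Real.pi * (a / (balabanFiber n hn a ha s hs hs0).φ μ * Dq s) := by ring
    _ ≤ Real.pi * Cc d := by gcongr

end TwoLevels

/-! ## §2 Admissible weight data between the levels and the `ℓ²` rates [folklore] -/

section Rate

variable {N R : ℕ} [NeZero N] [NeZero R]

/-- **ADMISSIBLE WEIGHT DATA in direction `ν` between the levels `N` and `RN`:** a weight on the level-`RN`
classes and one on the level-`N` classes, both DOMINATED by the derivative symbol `∂_ν`, whose PAIRED
difference along King's `ι` has the eta-rate `6‖q̃_k‖²/N` (the rate of `∂_ν` itself,
`B5G183RateL2.dSym_rate_le`).  Met by `∂`, `W∂` (`B5G183RatePieces.w1dSym_weight_hyps`) and every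
`W^θ∂`, `θ ≥ 0` (§7). [cite: King1986, (4.19)–(4.20) p.672, (4.29)–(4.31) p.673] [folklore] -/
structure AdmW (N R : ℕ) [NeZero N] [NeZero R] (s : Fin d → ℝ) (ν : Fin d)
    (wR : (Fin d → Fin (R * N)) → ℂ) (wN : (Fin d → Fin N) → ℂ) : Prop where
  domR : ∀ K, ‖wR K‖ ≤ ‖dSym (R * N) K s ν‖
  domN : ∀ k, ‖wN k‖ ≤ ‖dSym N k s ν‖
  rate : ∀ k, ‖wR (iota R k s) - wN k‖ ≤ 6 * ‖symmAlias N k s‖ ^ 2 / N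

/-- the hypotheses of the `B5G183RateL2` vector-rate lemmas (`c_w = 6`). [folklore] -/
theorem AdmW.hyps (hN : 1 ≤ N) {s : Fin d → ℝ} {ν : Fin d} {wR : (Fin d → Fin (R * N)) → ℂ}
    {wN : (Fin d → Fin N) → ℂ} (hw : AdmW N R s ν wR wN) :
    (∀ k : Fin d → Fin N, ‖wN k‖ ≤ ‖symmAlias N k s‖)
      ∧ ∀ k : Fin d → Fin N, ‖wR (iota R k s) - wN k‖ ≤ 6 * ‖symmAlias N k s‖ ^ 2 / N :=
  ⟨norm_le_alias_of_dom hN hw.domN, hw.rate⟩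

/-- **squared `ℓ²` eta-rate of `(w x_μ)′`:** `Σ_K |(wR x_μ)′^{(RN)}(K) − extV (wN x_μ)′^{(N)}(K)|² ≤ XR2/N²`
— King's `m = 0` classes through `xVec_rate_sq_le` (the centre class contributes `0`), the `|m| ≥ 1`
classes through `xVec_unpaired_sq_le`. [cite: King1986, (4.19)–(4.20), (4.23) p.672, (4.24) p.673;
Balaban1984PropagatorsI, (1.83) p.31] [folklore] -/
theorem sum_sq_xw_diff_le_of_adm (hN : 1 ≤ N) (hR : 1 ≤ R) (hRN : 1 ≤ R * N) (a : ℝ) (ha : 0 < a)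
    {s : Fin d → ℝ} (hs : ∀ ν, |s ν| ≤ Real.pi) (hs0 : s ≠ 0) {ν : Fin d}
    {wR : (Fin d → Fin (R * N)) → ℂ} {wN : (Fin d → Fin N) → ℂ} (hw : AdmW N R s ν wR wN) (μ : Fin d) :
    ∑ K, ‖(balabanFiber (R * N) hRN a ha s hs hs0).xw wR μ K
        - extV R s ((balabanFiber N hN a ha s hs hs0).xw wN) μ K‖ ^ 2
      ≤ XR2 d / (N : ℝ) ^ 2 := by
  obtain ⟨ν₀, hν₀⟩ : ∃ ν, s ν ≠ 0 := Function.ne_iff.mp hs0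
  have hN0 : (0 : ℝ) < N := by exact_mod_cast hN
  have hwgt := hw.hyps hN
  rw [sum_sq_sub_extV hN hs]
  -- paired classes: the centre term vanishes, the rest is `xVec_rate_sq_le`
  have hpaired : ∑ k : Fin d → Fin N,
      ‖(balabanFiber (R * N) hRN a ha s hs hs0).xw wR μ (iota R k s)
          - (balabanFiber N hN a ha s hs hs0).xw wN μ k‖ ^ 2
        ≤ 2 * ((Ax d * d * CXa d) ^ 2 + (6 * CXa d) ^ 2) * CW d / (N : ℝ) ^ 2 := by
    rw [← Finset.add_sum_erase _ _ (Finset.mem_univ (0 : Fin d → Fin N)), iota_zero hN hs,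
      xw_zero hRN a ha hs hs0, xw_zero hN a ha hs hs0, sub_zero, norm_zero, zero_pow two_ne_zero,
      zero_add]
    refine le_of_eq_of_le (Finset.sum_congr rfl fun k hk => ?_)
      (xVec_rate_sq_le hN hR hs ν₀ hν₀ μ (wN := wN) (wR := wR) (cw := 6) (by norm_num) hwgt.1 hwgt.2)
    have hk0 : k ≠ 0 := (Finset.mem_erase.mp hk).1
    have hK : iota R k s ≠ 0 := fun h => hk0 (iota_injective hN hs (h.trans (iota_zero hN hs).symm))
    rw [xw_ne hRN a ha hs hs0 _ μ hK, xw_ne hN a ha hs hs0 _ μ hk0, symmAlias_iota hN k hs,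
      norm_sub_rev]
  -- unpaired classes: `xVec_unpaired_sq_le`
  have hunp : ∑ K ∈ Finset.univ.filter (fun K => ∀ k : Fin d → Fin N, iota R k s ≠ K),
      ‖(balabanFiber (R * N) hRN a ha s hs hs0).xw wR μ K‖ ^ 2
        ≤ (CXa d / (Real.pi * N)) ^ 2 * CW d := by
    have hw1 : ∀ K : Fin d → Fin (R * N), ‖wR K‖ ≤ ‖symmAlias (R * N) K s‖ :=
      norm_le_alias_of_dom hRN hw.domR
    refine le_of_eq_of_le (Finset.sum_congr rfl fun K hK => ?_)
      (xVec_unpaired_sq_le hN hR hs ν₀ hν₀ μ hw1)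
    have hu := (Finset.mem_filter.mp hK).2
    have hK0 : K ≠ 0 := fun h => hu 0 ((iota_zero hN hs).trans h.symm)
    rw [xw_ne hRN a ha hs hs0 _ μ hK0]
  calc _ ≤ 2 * ((Ax d * d * CXa d) ^ 2 + (6 * CXa d) ^ 2) * CW d / (N : ℝ) ^ 2
          + (CXa d / (Real.pi * N)) ^ 2 * CW d := add_le_add hpaired hunp
    _ = XR2 d / (N : ℝ) ^ 2 := by unfold XR2; field_simp

/-- **`ℓ²` eta-rate of `(w x_μ)′`:** `|(wR x_μ)′^{(RN)} − extV (wN x_μ)′^{(N)}|₂ ≤ √XR2/N`. [folklore] -/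
theorem l2n_xw_diff_le_of_adm (hN : 1 ≤ N) (hR : 1 ≤ R) (hRN : 1 ≤ R * N) (a : ℝ) (ha : 0 < a)
    {s : Fin d → ℝ} (hs : ∀ ν, |s ν| ≤ Real.pi) (hs0 : s ≠ 0) {ν : Fin d}
    {wR : (Fin d → Fin (R * N)) → ℂ} {wN : (Fin d → Fin N) → ℂ} (hw : AdmW N R s ν wR wN) (μ : Fin d) :
    l2n ((balabanFiber (R * N) hRN a ha s hs hs0).xw wR μ
        - extV R s ((balabanFiber N hN a ha s hs hs0).xw wN) μ)
      ≤ Real.sqrt (XR2 d) / N := by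
  have hN0 : (0 : ℝ) < N := by exact_mod_cast hN
  have hX := XR2_nonneg d
  refine l2n_le_of_sq_le (by positivity) ?_
  rw [div_pow, Real.sq_sqrt hX]
  exact sum_sq_xw_diff_le_of_adm hN hR hRN a ha hs hs0 hw μ

/-- the weight rate at the centre: `|wR(p′) − wN(p′)| ≤ 6π²/N` (the paired rate at the centre class).
[folklore] -/
theorem centre_wrate_of_adm (hN : 1 ≤ N) {s : Fin d → ℝ} (hs : ∀ ν, |s ν| ≤ Real.pi) {ν : Fin d}
    {wR : (Fin d → Fin (R * N)) → ℂ} {wN : (Fin d → Fin N) → ℂ} (hw : AdmW N R s ν wR wN) :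
    ‖wR 0 - wN 0‖ ≤ 6 * Real.pi ^ 2 / N := by
  have hN0 : (0 : ℝ) < N := by exact_mod_cast hN
  have h := hw.rate 0
  rw [iota_zero hN hs, symmAlias_zero hN hs] at h
  have hsn := norm_le_pi hs
  calc ‖wR 0 - wN 0‖ ≤ 6 * ‖s‖ ^ 2 / N := h
    _ ≤ 6 * Real.pi ^ 2 / N := by gcongr

/-- the squared `ℓ²` distance of the centre vectors between the levels is the centre term alone:
`Σ_K |(wR x_μ)°^{(RN)}(K) − extV (wN x_μ)°^{(N)}(K)|² = |wR(p′)xP^{(RN)}(p′) − wN(p′)xP^{(N)}(p′)|²`.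
[folklore] -/
theorem sum_sq_xo_diff_w (hN : 1 ≤ N) (hRN : 1 ≤ R * N) (a : ℝ) (ha : 0 < a)
    {s : Fin d → ℝ} (hs : ∀ ν, |s ν| ≤ Real.pi) (hs0 : s ≠ 0)
    (wR : (Fin d → Fin (R * N)) → ℂ) (wN : (Fin d → Fin N) → ℂ) (μ : Fin d) :
    ∑ K, ‖(balabanFiber (R * N) hRN a ha s hs hs0).xo wR μ K
        - extV R s ((balabanFiber N hN a ha s hs hs0).xo wN) μ K‖ ^ 2
      = ‖wR 0 * xP (R * N) μ s - wN 0 * xP N μ s‖ ^ 2 := by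
  rw [sum_sq_sub_extV hN hs, ← Finset.add_sum_erase _ _ (Finset.mem_univ (0 : Fin d → Fin N)),
    iota_zero hN hs, xo_zero hRN a ha hs hs0, xo_zero hN a ha hs hs0]
  have h1 : ∑ k ∈ Finset.univ.erase (0 : Fin d → Fin N),
      ‖(balabanFiber (R * N) hRN a ha s hs hs0).xo wR μ (iota R k s)
        - (balabanFiber N hN a ha s hs hs0).xo wN μ k‖ ^ 2 = 0 := by
    refine Finset.sum_eq_zero fun k hk => ?_
    have hk0 : k ≠ 0 := (Finset.mem_erase.mp hk).1
    have hK : iota R k s ≠ 0 := fun h => hk0 (iota_injective hN hs (h.trans (iota_zero hN hs).symm))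
    rw [xo_ne hRN a ha hs hs0 _ μ hK, xo_ne hN a ha hs hs0 _ μ hk0, sub_zero, norm_zero,
      zero_pow two_ne_zero]
  have h2 : ∑ K ∈ Finset.univ.filter (fun K => ∀ k : Fin d → Fin N, iota R k s ≠ K),
      ‖(balabanFiber (R * N) hRN a ha s hs hs0).xo wR μ K‖ ^ 2 = 0 := by
    refine Finset.sum_eq_zero fun K hK => ?_
    have hu := (Finset.mem_filter.mp hK).2
    have hK0 : K ≠ 0 := fun h => hu 0 ((iota_zero hN hs).trans h.symm)
    rw [xo_ne hRN a ha hs hs0 _ μ hK0, norm_zero, zero_pow two_ne_zero]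
  rw [h1, h2, add_zero, add_zero]

/-- **centre rate:** `aφ^{(N)}_μ(p′)⁻¹ · |(wR x_μ)°^{(RN)} − extV (wN x_μ)°^{(N)}|₂ ≤ CK2(d)/N` — the weight
rate `6π²/N` against `|xP^{(RN)}(p′)| ≤ D(p′)`, and `|wN(p′)| ≤ π` against the centre x-rate
`A_x dπ D(p′)/N` (`B5G183RateW1BlockC.xP_centre_rate`), both paid by «the additional factor Δ₀»
(`coef_Dq_le`). [cite: King1986, (4.19) p.672; Balaban1984PropagatorsI, (1.85) p.32] [folklore] -/
theorem centre_rate_le_of_adm (hN : 1 ≤ N) (hR : 1 ≤ R) (hRN : 1 ≤ R * N) (a : ℝ) (ha : 0 < a)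
    {s : Fin d → ℝ} (hs : ∀ ν, |s ν| ≤ Real.pi) (hs0 : s ≠ 0) {ν : Fin d}
    {wR : (Fin d → Fin (R * N)) → ℂ} {wN : (Fin d → Fin N) → ℂ} (hw : AdmW N R s ν wR wN) (μ : Fin d) :
    a / (balabanFiber N hN a ha s hs hs0).φ μ
        * l2n ((balabanFiber (R * N) hRN a ha s hs hs0).xo wR μ
            - extV R s ((balabanFiber N hN a ha s hs hs0).xo wN) μ)
      ≤ CK2 d / N := by
  have hN0 : (0 : ℝ) < N := by exact_mod_cast hN
  have hφ := (balabanFiber N hN a ha s hs hs0).φ_pos μ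
  have h0 : 0 ≤ a / (balabanFiber N hN a ha s hs hs0).φ μ := div_nonneg ha.le hφ.le
  have hD := Dq_nonneg s
  have hA : 0 ≤ Ax d := by unfold Ax; positivity
  have hxR := norm_xP_le_Dq hRN hs hs0 μ
  have hwN := norm_centre_le_pi_of_dom hN hs hw.domN
  have hdw := centre_wrate_of_adm hN hs hw
  have hdx := xP_centre_rate (N := N) (R := R) hN hR hs hs0 μ
  have hc := coef_Dq_le hN a ha hs hs0 μ
  set B : ℝ := 6 * Real.pi ^ 2 / N * Dq s + Real.pi * (Ax d * d * Real.pi / N * Dq s) with hB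
  have hB0 : 0 ≤ B := by positivity
  have hz : ‖wR 0 * xP (R * N) μ s - wN 0 * xP N μ s‖ ≤ B := by
    have e : wR 0 * xP (R * N) μ s - wN 0 * xP N μ s
        = (wR 0 - wN 0) * xP (R * N) μ s + wN 0 * (xP (R * N) μ s - xP N μ s) := by ring
    rw [e]
    refine (norm_add_le _ _).trans ?_
    rw [norm_mul, norm_mul, norm_sub_rev (xP (R * N) μ s)]
    exact add_le_add (mul_le_mul hdw hxR (norm_nonneg _) (by positivity))
      (mul_le_mul hwN hdx (norm_nonneg _) Real.pi_pos.le)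
  have hl : l2n ((balabanFiber (R * N) hRN a ha s hs hs0).xo wR μ
      - extV R s ((balabanFiber N hN a ha s hs hs0).xo wN) μ) ≤ B := by
    refine l2n_le_of_sq_le hB0 ?_
    have h := sum_sq_xo_diff_w hN hRN a ha hs hs0 wR wN μ
    simp only [Pi.sub_apply] at h ⊢
    rw [h]
    exact pow_le_pow_left₀ (norm_nonneg _) hz 2
  calc _ ≤ a / (balabanFiber N hN a ha s hs hs0).φ μ * B := by gcongr
    _ = (a / (balabanFiber N hN a ha s hs hs0).φ μ * Dq s)
          * ((6 * Real.pi ^ 2 + Real.pi ^ 2 * (Ax d * d)) / N) := by rw [hB]; field_simp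
    _ ≤ Cc d * ((6 * Real.pi ^ 2 + Real.pi ^ 2 * (Ax d * d)) / N) := by gcongr
    _ = CK2 d / N := by unfold CK2; ring

end Rate

/-! ## §3 The x-block piece `R` for admissible weights is `O(1/N)` [folklore] -/

section PieceR

variable {N R : ℕ} [NeZero N] [NeZero R]

/-- **THE x-BLOCK PIECE `R` FOR ADMISSIBLE WEIGHTS IS `O(1/N)`:**
`‖blockR cR^{(RN)} (wa x)′^{(RN)} (wb x)′^{(RN)} − blockR cR^{(N)} (extV (wa′ x)′^{(N)}) (extV (wb′ x)′^{(N)})‖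
≤ CRW1(d,a)/N` — the trilinear split `B5G183RatePieces.opNorm_blockR_sub_blockR_le` with the coefficient
rate `B5G183RateW1BlockR.cR_diff_le`, the vector rates `l2n_xw_diff_le_of_adm` and the uniform sizes
`|(wx)′|₂ ≤ 1`, `|cR| ≤ a`. [cite: Balaban1984PropagatorsI, (1.83) p.31, Prop. 1.1 (1.89) p.33; King1986,
(4.19)–(4.20), (4.23) p.672, (4.24) p.673] [folklore] -/
theorem opNorm_R_piece_le_of_adm (hN : 1 ≤ N) (hR : 1 ≤ R) (hRN : 1 ≤ R * N) (a : ℝ) (ha : 0 < a)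
    {s : Fin d → ℝ} (hs : ∀ ν, |s ν| ≤ Real.pi) (hs0 : s ≠ 0) {ν ν' : Fin d}
    {wa wb : (Fin d → Fin (R * N)) → ℂ} {wa' wb' : (Fin d → Fin N) → ℂ}
    (hwa : AdmW N R s ν wa wa') (hwb : AdmW N R s ν' wb wb') :
    let F := balabanFiber (R * N) hRN a ha s hs hs0
    let F' := balabanFiber N hN a ha s hs hs0
    ‖blockR F.cR (F.xw wa) (F.xw wb) - blockR F'.cR (extV R s (F'.xw wa')) (extV R s (F'.xw wb'))‖
      ≤ CRW1 d a / N := by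
  intro F F'
  have hN0 : (0 : ℝ) < N := by exact_mod_cast hN
  have hN1 : (1 : ℝ) ≤ N := by exact_mod_cast hN
  have hC := B5ActionRate166.Cphi_pos
  have hX : 0 ≤ Real.sqrt (XR2 d) := Real.sqrt_nonneg _
  -- sizes
  have hszRa := fun μ => l2n_xw_le_one_of_dom hRN a ha hs hs0 hwa.domR μ
  have hszRb := fun μ => l2n_xw_le_one_of_dom hRN a ha hs hs0 hwb.domR μ
  have hszNa := fun μ => l2n_xw_le_one_of_dom hN a ha hs hs0 hwa.domN μ
  have hcN := fun μ => norm_cR_le hN a ha hs hs0 μ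
  -- rates
  have hcd := fun μ => cR_diff_le hN hR hRN a ha hs hs0 μ
  have hva := fun μ => l2n_xw_diff_le_of_adm hN hR hRN a ha hs hs0 hwa μ
  have hvb := fun μ => l2n_xw_diff_le_of_adm hN hR hRN a ha hs hs0 hwb μ
  have key := opNorm_blockR_sub_blockR_le F.cR F'.cR
    (F.xw wa) (extV R s (F'.xw wa')) (F.xw wb) (extV R s (F'.xw wb'))
    (K₁ := a ^ 2 * B5ActionRate166.Cphi / (N : ℝ) ^ 2) (K₂ := a * (Real.sqrt (XR2 d) / N))
    (K₃ := a * (Real.sqrt (XR2 d) / N)) (by positivity) (by positivity) (by positivity)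
    (fun μ => by
      calc _ ≤ a ^ 2 * B5ActionRate166.Cphi / (N : ℝ) ^ 2 * (1 * 1) := by
            gcongr
            · exact mul_nonneg (l2n_nonneg _) (l2n_nonneg _)
            · exact hcd μ
            · exact l2n_nonneg _
            · exact hszRa μ
            · exact hszRb μ
        _ = _ := by ring)
    (fun μ => by
      calc _ ≤ a * (Real.sqrt (XR2 d) / N * 1) := by
            gcongr
            · exact mul_nonneg (l2n_nonneg _) (l2n_nonneg _)
            · exact hcN μ
            · exact l2n_nonneg _
            · exact hva μ
            · exact hszRb μ
        _ = _ := by ring)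
    (fun μ => by
      rw [l2n_extV hN hs]
      calc _ ≤ a * (1 * (Real.sqrt (XR2 d) / N)) := by
            gcongr
            · exact mul_nonneg (l2n_nonneg _) (l2n_nonneg _)
            · exact hcN μ
            · exact l2n_nonneg _
            · exact hszNa μ
            · exact hvb μ
        _ = _ := by ring)
  refine key.trans ?_
  have h2 : a ^ 2 * B5ActionRate166.Cphi / (N : ℝ) ^ 2 ≤ a ^ 2 * B5ActionRate166.Cphi / N :=
    div_le_div_of_nonneg_left (by positivity) hN0 (by nlinarith)
  calc a ^ 2 * B5ActionRate166.Cphi / (N : ℝ) ^ 2 + a * (Real.sqrt (XR2 d) / N)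
        + a * (Real.sqrt (XR2 d) / N)
      ≤ a ^ 2 * B5ActionRate166.Cphi / N + a * (Real.sqrt (XR2 d) / N)
        + a * (Real.sqrt (XR2 d) / N) := by gcongr
    _ = CRW1 d a / N := by unfold CRW1; ring

end PieceR

/-! ## §4 The centre x-block pieces `C1`, `C2` for admissible weights are `O(1/N)` [folklore] -/

section PieceC

variable {N R : ℕ} [NeZero N] [NeZero R]

/-- **THE CENTRE x-BLOCK PIECE `C1 = cR (wa x)° ⊗ (wb x)′` FOR ADMISSIBLE WEIGHTS IS `O(1/N)`.** Trilinear
split: the coefficient rate `B5G183RateW1BlockC.cR_diff_le'` against the centre size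
(`centre_size_le_of_dom`), the centre rate `centre_rate_le_of_adm`, and the off-centre vector rate
`l2n_xw_diff_le_of_adm` against the centre size. [cite: Balaban1984PropagatorsI, (1.83) p.31, (1.85)
p.32, Prop. 1.1 (1.89) p.33; King1986, (4.19)–(4.20) p.672] [folklore] -/
theorem opNorm_C1_piece_le_of_adm (hN : 1 ≤ N) (hR : 1 ≤ R) (hRN : 1 ≤ R * N) (a : ℝ) (ha : 0 < a)
    {s : Fin d → ℝ} (hs : ∀ ν, |s ν| ≤ Real.pi) (hs0 : s ≠ 0) {ν ν' : Fin d}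
    {wa wb : (Fin d → Fin (R * N)) → ℂ} {wa' wb' : (Fin d → Fin N) → ℂ}
    (hwa : AdmW N R s ν wa wa') (hwb : AdmW N R s ν' wb wb') :
    let F := balabanFiber (R * N) hRN a ha s hs hs0
    let F' := balabanFiber N hN a ha s hs hs0
    ‖blockR F.cR (F.xo wa) (F.xw wb) - blockR F'.cR (extV R s (F'.xo wa')) (extV R s (F'.xw wb'))‖
      ≤ CCW1 d a / N := by
  intro F F'
  have hN0 : (0 : ℝ) < N := by exact_mod_cast hN
  have hN1 : (1 : ℝ) ≤ N := by exact_mod_cast hN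
  have hC := B5ActionRate166.Cphi_pos
  have hc := Cc_nonneg d
  have hk := CK2_nonneg d
  have hX : 0 ≤ Real.sqrt (XR2 d) := Real.sqrt_nonneg _
  have hszRb := fun μ => l2n_xw_le_one_of_dom hRN a ha hs hs0 hwb.domR μ
  have hcRN : ∀ μ, ‖F'.cR μ‖ = a / F'.φ μ := fun μ => by rw [Fiber.norm_cR]; rfl
  have hφR := fun μ => F.φ_pos μ
  have hφN := fun μ => F'.φ_pos μ
  have hcd := fun μ => cR_diff_le' hN hR hRN a ha hs hs0 μ
  have hcsR := fun μ => centre_size_le_of_dom hRN hRN a ha hs hs0 hwa.domR μ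
  have hcsN := fun μ => centre_size_le_of_dom hN hN a ha hs hs0 hwa.domN μ
  have hcr := fun μ => centre_rate_le_of_adm hN hR hRN a ha hs hs0 hwa μ
  have hvb := fun μ => l2n_xw_diff_le_of_adm hN hR hRN a ha hs hs0 hwb μ
  have key := opNorm_blockR_sub_blockR_le F.cR F'.cR
    (F.xo wa) (extV R s (F'.xo wa')) (F.xw wb) (extV R s (F'.xw wb'))
    (K₁ := Real.pi * Cc d * (a * B5ActionRate166.Cphi / (N : ℝ) ^ 2)) (K₂ := CK2 d / N)
    (K₃ := Real.pi * Cc d * (Real.sqrt (XR2 d) / N)) (by positivity) (by positivity) (by positivity)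
    (fun μ => by
      have h0 : 0 ≤ l2n (F.xo wa μ) := l2n_nonneg _
      have hB0 : 0 ≤ a / F.φ μ * (a * B5ActionRate166.Cphi / (N : ℝ) ^ 2) :=
        mul_nonneg (div_nonneg ha.le (hφR μ).le) (by positivity)
      calc ‖F.cR μ - F'.cR μ‖ * (l2n (F.xo wa μ) * l2n (F.xw wb μ))
          ≤ (a / F.φ μ * (a * B5ActionRate166.Cphi / (N : ℝ) ^ 2)) * (l2n (F.xo wa μ) * 1) :=
            mul_le_mul (hcd μ) (mul_le_mul_of_nonneg_left (hszRb μ) h0)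
              (mul_nonneg h0 (l2n_nonneg _)) hB0
        _ = (a / F.φ μ * l2n (F.xo wa μ)) * (a * B5ActionRate166.Cphi / (N : ℝ) ^ 2) := by ring
        _ ≤ Real.pi * Cc d * (a * B5ActionRate166.Cphi / (N : ℝ) ^ 2) :=
            mul_le_mul_of_nonneg_right (hcsR μ) (by positivity))
    (fun μ => by
      rw [hcRN μ]
      have h0 : 0 ≤ l2n (F.xo wa μ - extV R s (F'.xo wa') μ) := l2n_nonneg _
      have hφ0 : 0 ≤ a / F'.φ μ := div_nonneg ha.le (hφN μ).le
      calc a / F'.φ μ * (l2n (F.xo wa μ - extV R s (F'.xo wa') μ) * l2n (F.xw wb μ))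
          ≤ a / F'.φ μ * (l2n (F.xo wa μ - extV R s (F'.xo wa') μ) * 1) :=
            mul_le_mul_of_nonneg_left (mul_le_mul_of_nonneg_left (hszRb μ) h0) hφ0
        _ = a / F'.φ μ * l2n (F.xo wa μ - extV R s (F'.xo wa') μ) := by ring
        _ ≤ CK2 d / N := hcr μ)
    (fun μ => by
      rw [hcRN μ, l2n_extV hN hs]
      have h0 : 0 ≤ l2n (F'.xo wa' μ) := l2n_nonneg _
      have hφ0 : 0 ≤ a / F'.φ μ := div_nonneg ha.le (hφN μ).le
      calc a / F'.φ μ * (l2n (F'.xo wa' μ) * l2n (F.xw wb μ - extV R s (F'.xw wb') μ))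
          ≤ a / F'.φ μ * (l2n (F'.xo wa' μ) * (Real.sqrt (XR2 d) / N)) :=
            mul_le_mul_of_nonneg_left (mul_le_mul_of_nonneg_left (hvb μ) h0) hφ0
        _ = (a / F'.φ μ * l2n (F'.xo wa' μ)) * (Real.sqrt (XR2 d) / N) := by ring
        _ ≤ Real.pi * Cc d * (Real.sqrt (XR2 d) / N) :=
            mul_le_mul_of_nonneg_right (hcsN μ) (by positivity))
  refine key.trans ?_
  have h2 : a * B5ActionRate166.Cphi / (N : ℝ) ^ 2 ≤ a * B5ActionRate166.Cphi / N :=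
    div_le_div_of_nonneg_left (by positivity) hN0 (by nlinarith)
  calc Real.pi * Cc d * (a * B5ActionRate166.Cphi / (N : ℝ) ^ 2) + CK2 d / N
        + Real.pi * Cc d * (Real.sqrt (XR2 d) / N)
      ≤ Real.pi * Cc d * (a * B5ActionRate166.Cphi / N) + CK2 d / N
        + Real.pi * Cc d * (Real.sqrt (XR2 d) / N) := by gcongr
    _ = CCW1 d a / N := by unfold CCW1; ring

/-- **THE CENTRE x-BLOCK PIECE `C2 = cR (wa x)′ ⊗ (wb x)°` FOR ADMISSIBLE WEIGHTS IS `O(1/N)`** (mirror of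
`C1`). [cite: Balaban1984PropagatorsI, (1.83) p.31, (1.85) p.32, Prop. 1.1 (1.89) p.33; King1986,
(4.19)–(4.20) p.672] [folklore] -/
theorem opNorm_C2_piece_le_of_adm (hN : 1 ≤ N) (hR : 1 ≤ R) (hRN : 1 ≤ R * N) (a : ℝ) (ha : 0 < a)
    {s : Fin d → ℝ} (hs : ∀ ν, |s ν| ≤ Real.pi) (hs0 : s ≠ 0) {ν ν' : Fin d}
    {wa wb : (Fin d → Fin (R * N)) → ℂ} {wa' wb' : (Fin d → Fin N) → ℂ}
    (hwa : AdmW N R s ν wa wa') (hwb : AdmW N R s ν' wb wb') :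
    let F := balabanFiber (R * N) hRN a ha s hs hs0
    let F' := balabanFiber N hN a ha s hs hs0
    ‖blockR F.cR (F.xw wa) (F.xo wb) - blockR F'.cR (extV R s (F'.xw wa')) (extV R s (F'.xo wb'))‖
      ≤ CCW1 d a / N := by
  intro F F'
  have hN0 : (0 : ℝ) < N := by exact_mod_cast hN
  have hN1 : (1 : ℝ) ≤ N := by exact_mod_cast hN
  have hC := B5ActionRate166.Cphi_pos
  have hc := Cc_nonneg d
  have hk := CK2_nonneg d
  have hX : 0 ≤ Real.sqrt (XR2 d) := Real.sqrt_nonneg _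
  have hszRa := fun μ => l2n_xw_le_one_of_dom hRN a ha hs hs0 hwa.domR μ
  have hszNa := fun μ => l2n_xw_le_one_of_dom hN a ha hs hs0 hwa.domN μ
  have hcRN : ∀ μ, ‖F'.cR μ‖ = a / F'.φ μ := fun μ => by rw [Fiber.norm_cR]; rfl
  have hφR := fun μ => F.φ_pos μ
  have hφN := fun μ => F'.φ_pos μ
  have hcd := fun μ => cR_diff_le' hN hR hRN a ha hs hs0 μ
  have hcsRR := fun μ => centre_size_le_of_dom hRN hRN a ha hs hs0 hwb.domR μ
  have hcsNR := fun μ => centre_size_le_of_dom hN hRN a ha hs hs0 hwb.domR μ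
  have hcr := fun μ => centre_rate_le_of_adm hN hR hRN a ha hs hs0 hwb μ
  have hva := fun μ => l2n_xw_diff_le_of_adm hN hR hRN a ha hs hs0 hwa μ
  have key := opNorm_blockR_sub_blockR_le F.cR F'.cR
    (F.xw wa) (extV R s (F'.xw wa')) (F.xo wb) (extV R s (F'.xo wb'))
    (K₁ := Real.pi * Cc d * (a * B5ActionRate166.Cphi / (N : ℝ) ^ 2))
    (K₂ := Real.pi * Cc d * (Real.sqrt (XR2 d) / N)) (K₃ := CK2 d / N)
    (by positivity) (by positivity) (by positivity)
    (fun μ => by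
      have h0 : 0 ≤ l2n (F.xo wb μ) := l2n_nonneg _
      have hB0 : 0 ≤ a / F.φ μ * (a * B5ActionRate166.Cphi / (N : ℝ) ^ 2) :=
        mul_nonneg (div_nonneg ha.le (hφR μ).le) (by positivity)
      calc ‖F.cR μ - F'.cR μ‖ * (l2n (F.xw wa μ) * l2n (F.xo wb μ))
          ≤ (a / F.φ μ * (a * B5ActionRate166.Cphi / (N : ℝ) ^ 2)) * (1 * l2n (F.xo wb μ)) :=
            mul_le_mul (hcd μ) (mul_le_mul_of_nonneg_right (hszRa μ) h0)
              (mul_nonneg (l2n_nonneg _) h0) hB0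
        _ = (a / F.φ μ * l2n (F.xo wb μ)) * (a * B5ActionRate166.Cphi / (N : ℝ) ^ 2) := by ring
        _ ≤ Real.pi * Cc d * (a * B5ActionRate166.Cphi / (N : ℝ) ^ 2) :=
            mul_le_mul_of_nonneg_right (hcsRR μ) (by positivity))
    (fun μ => by
      rw [hcRN μ]
      have h0 : 0 ≤ l2n (F.xo wb μ) := l2n_nonneg _
      have hφ0 : 0 ≤ a / F'.φ μ := div_nonneg ha.le (hφN μ).le
      calc a / F'.φ μ * (l2n (F.xw wa μ - extV R s (F'.xw wa') μ) * l2n (F.xo wb μ))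
          ≤ a / F'.φ μ * ((Real.sqrt (XR2 d) / N) * l2n (F.xo wb μ)) :=
            mul_le_mul_of_nonneg_left (mul_le_mul_of_nonneg_right (hva μ) h0) hφ0
        _ = (a / F'.φ μ * l2n (F.xo wb μ)) * (Real.sqrt (XR2 d) / N) := by ring
        _ ≤ Real.pi * Cc d * (Real.sqrt (XR2 d) / N) :=
            mul_le_mul_of_nonneg_right (hcsNR μ) (by positivity))
    (fun μ => by
      rw [hcRN μ, l2n_extV hN hs]
      have h0 : 0 ≤ l2n (F.xo wb μ - extV R s (F'.xo wb') μ) := l2n_nonneg _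
      have hφ0 : 0 ≤ a / F'.φ μ := div_nonneg ha.le (hφN μ).le
      calc a / F'.φ μ * (l2n (F'.xw wa' μ) * l2n (F.xo wb μ - extV R s (F'.xo wb') μ))
          ≤ a / F'.φ μ * (1 * l2n (F.xo wb μ - extV R s (F'.xo wb') μ)) :=
            mul_le_mul_of_nonneg_left (mul_le_mul_of_nonneg_right (hszNa μ) h0) hφ0
        _ = a / F'.φ μ * l2n (F.xo wb μ - extV R s (F'.xo wb') μ) := by ring
        _ ≤ CK2 d / N := hcr μ)
  refine key.trans ?_
  have h2 : a * B5ActionRate166.Cphi / (N : ℝ) ^ 2 ≤ a * B5ActionRate166.Cphi / N :=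
    div_le_div_of_nonneg_left (by positivity) hN0 (by nlinarith)
  calc Real.pi * Cc d * (a * B5ActionRate166.Cphi / (N : ℝ) ^ 2)
        + Real.pi * Cc d * (Real.sqrt (XR2 d) / N) + CK2 d / N
      ≤ Real.pi * Cc d * (a * B5ActionRate166.Cphi / N)
        + Real.pi * Cc d * (Real.sqrt (XR2 d) / N) + CK2 d / N := by gcongr
    _ = CCW1 d a / N := by unfold CCW1; ring

end PieceC

/-! ## §5 The rank-one piece `T` for admissible weights is `O(1/N)` [folklore] -/

section PieceT

variable {N R : ℕ} [NeZero N] [NeZero R]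

/-- **uniform size:** `|bRw(w)|₂² ≤ d·Bsq` for a dominated weight (`B5G183RateL2.bVec_sq_le`, all classes
incl. the centre). [cite: Balaban1984PropagatorsI, (1.88) p.32; King1986, (4.20) p.672] [folklore] -/
theorem sum_sq_bRw_le_of_dom {n : ℕ} [NeZero n] (hn : 1 ≤ n) (a : ℝ) (ha : 0 < a) {s : Fin d → ℝ}
    (hs : ∀ ν, |s ν| ≤ Real.pi) (hs0 : s ≠ 0) {ν : Fin d} {w : (Fin d → Fin n) → ℂ}
    (hw : ∀ K, ‖w K‖ ≤ ‖dSym n K s ν‖) :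
    ∑ I, ‖bRw n a s w I‖ ^ 2 ≤ d * Bsq d a := by
  obtain ⟨ν₀, hν₀⟩ : ∃ ν, s ν ≠ 0 := Function.ne_iff.mp hs0
  have hw' : ∀ K : Fin d → Fin n, ‖w K‖ ≤ ‖symmAlias n K s‖ := norm_le_alias_of_dom hn hw
  rw [Fintype.sum_prod_type, Finset.sum_comm]
  calc ∑ μ : Fin d, ∑ K : Fin d → Fin n, ‖bRw n a s w (K, μ)‖ ^ 2
      ≤ ∑ _μ : Fin d, Bsq d a := Finset.sum_le_sum fun μ _ => by
        unfold bRw Bsq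
        exact bVec_sq_le hn a ha hs ν₀ hν₀ μ hw'
    _ = d * Bsq d a := by simp

/-- `|bRw(w)|₂ ≤ √(d·Bsq)`. [folklore] -/
theorem l2n_bRw_le_of_dom {n : ℕ} [NeZero n] (hn : 1 ≤ n) (a : ℝ) (ha : 0 < a) {s : Fin d → ℝ}
    (hs : ∀ ν, |s ν| ≤ Real.pi) (hs0 : s ≠ 0) {ν : Fin d} {w : (Fin d → Fin n) → ℂ}
    (hw : ∀ K, ‖w K‖ ≤ ‖dSym n K s ν‖) :
    l2n (bRw n a s w) ≤ Real.sqrt (d * Bsq d a) := by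
  refine l2n_le_of_sq_le (Real.sqrt_nonneg _) ?_
  rw [Real.sq_sqrt (by have := Bsq_nonneg d a; positivity)]
  exact sum_sq_bRw_le_of_dom hn a ha hs hs0 hw

/-- `|extP bRw^{(N)}(w)|₂ ≤ √(d·Bsq)`. [folklore] -/
theorem l2n_extP_bRw_le_of_dom (hN : 1 ≤ N) (a : ℝ) (ha : 0 < a) {s : Fin d → ℝ}
    (hs : ∀ ν, |s ν| ≤ Real.pi) (hs0 : s ≠ 0) {ν : Fin d} {w : (Fin d → Fin N) → ℂ}
    (hw : ∀ K, ‖w K‖ ≤ ‖dSym N K s ν‖) :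
    l2n (extP R s (bRw N a s w)) ≤ Real.sqrt (d * Bsq d a) := by
  refine l2n_le_of_sq_le (Real.sqrt_nonneg _) ?_
  rw [Real.sq_sqrt (by have := Bsq_nonneg d a; positivity), sum_sq_extP hN hs]
  exact sum_sq_bRw_le_of_dom hN a ha hs hs0 hw

/-- **squared `ℓ²` eta-rate of the regularised bracket vector for admissible weights:**
`Σ_I |bRw^{(RN)}(wR)(I) − extP bRw^{(N)}(wN)(I)|² ≤ d·Brate/N²` — King's `m = 0` classes through
`bVec_rate_sq_le`, the `|m| ≥ 1` classes through `bVec_unpaired_sq_le`. [cite: King1986, (4.19)–(4.20),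
(4.23) p.672, (4.24) p.673; Balaban1984PropagatorsI, (1.88) p.32] [folklore] -/
theorem sum_sq_bRw_diff_le_of_adm (hN : 1 ≤ N) (hR : 1 ≤ R) (hRN : 1 ≤ R * N) (a : ℝ) (ha : 0 < a)
    {s : Fin d → ℝ} (hs : ∀ ν, |s ν| ≤ Real.pi) (hs0 : s ≠ 0) {ν : Fin d}
    {wR : (Fin d → Fin (R * N)) → ℂ} {wN : (Fin d → Fin N) → ℂ} (hw : AdmW N R s ν wR wN) :
    ∑ I, ‖bRw (R * N) a s wR I - extP R s (bRw N a s wN) I‖ ^ 2 ≤ d * Brate d a / (N : ℝ) ^ 2 := by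
  obtain ⟨ν₀, hν₀⟩ : ∃ ν, s ν ≠ 0 := Function.ne_iff.mp hs0
  have hN0 : (0 : ℝ) < N := by exact_mod_cast hN
  have hwgt := hw.hyps hN
  have hw1 : ∀ K : Fin d → Fin (R * N), ‖wR K‖ ≤ ‖symmAlias (R * N) K s‖ :=
    norm_le_alias_of_dom hRN hw.domR
  rw [sum_sq_sub_extP hN hs]
  have hpaired : ∑ k : Fin d → Fin N, ∑ μ : Fin d,
      ‖bRw (R * N) a s wR (iota R k s, μ) - bRw N a s wN (k, μ)‖ ^ 2
        ≤ d * (CbRate d a 6 / (N : ℝ) ^ 2) := by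
    rw [Finset.sum_comm]
    calc ∑ μ : Fin d, ∑ k : Fin d → Fin N,
          ‖bRw (R * N) a s wR (iota R k s, μ) - bRw N a s wN (k, μ)‖ ^ 2
        ≤ ∑ _μ : Fin d, CbRate d a 6 / (N : ℝ) ^ 2 := Finset.sum_le_sum fun μ _ => by
          refine le_of_eq_of_le (Finset.sum_congr rfl fun k _ => ?_)
            (bVec_rate_sq_le hN hR a ha hs ν₀ hν₀ μ (wN := wN) (wR := wR) (cw := 6) (by norm_num)
              hwgt.1 hwgt.2)
          unfold bRw
          rw [symmAlias_iota hN k hs, norm_sub_rev]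
      _ = d * (CbRate d a 6 / (N : ℝ) ^ 2) := by simp
  have hunp : ∑ K ∈ Finset.univ.filter (fun K => ∀ k : Fin d → Fin N, iota R k s ≠ K), ∑ μ : Fin d,
      ‖bRw (R * N) a s wR (K, μ)‖ ^ 2 ≤ d * ((CBa d / (Real.pi * N)) ^ 2 * CW d) := by
    rw [Finset.sum_comm]
    calc ∑ μ : Fin d, ∑ K ∈ Finset.univ.filter (fun K => ∀ k : Fin d → Fin N, iota R k s ≠ K),
          ‖bRw (R * N) a s wR (K, μ)‖ ^ 2
        ≤ ∑ _μ : Fin d, (CBa d / (Real.pi * N)) ^ 2 * CW d := Finset.sum_le_sum fun μ _ => by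
          unfold bRw
          exact bVec_unpaired_sq_le hN hR a ha hs ν₀ hν₀ μ hw1
      _ = d * ((CBa d / (Real.pi * N)) ^ 2 * CW d) := by simp
  calc _ ≤ d * (CbRate d a 6 / (N : ℝ) ^ 2) + d * ((CBa d / (Real.pi * N)) ^ 2 * CW d) :=
        add_le_add hpaired hunp
    _ = d * Brate d a / (N : ℝ) ^ 2 := by unfold Brate; field_simp

/-- **`ℓ²` eta-rate of the regularised bracket vector:** `≤ √(d·Brate)/N`. [folklore] -/
theorem l2n_bRw_diff_le_of_adm (hN : 1 ≤ N) (hR : 1 ≤ R) (hRN : 1 ≤ R * N) (a : ℝ) (ha : 0 < a)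
    {s : Fin d → ℝ} (hs : ∀ ν, |s ν| ≤ Real.pi) (hs0 : s ≠ 0) {ν : Fin d}
    {wR : (Fin d → Fin (R * N)) → ℂ} {wN : (Fin d → Fin N) → ℂ} (hw : AdmW N R s ν wR wN) :
    l2n (bRw (R * N) a s wR - extP R s (bRw N a s wN)) ≤ Real.sqrt (d * Brate d a) / N := by
  have hN0 : (0 : ℝ) < N := by exact_mod_cast hN
  have hB : 0 ≤ (d : ℝ) * Brate d a := by have := Brate_nonneg d a; positivity
  refine l2n_le_of_sq_le (by positivity) ?_
  rw [div_pow, Real.sq_sqrt hB]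
  have h := sum_sq_bRw_diff_le_of_adm hN hR hRN a ha hs hs0 hw
  simp only [Pi.sub_apply] at h ⊢
  exact h

/-- **THE RANK-ONE PIECE `T` FOR ADMISSIBLE WEIGHTS IS `O(1/N)`:**
`‖cT^{(RN)}(wa b)⊗(wb b)̄ − rankOne cT^{(N)} (extP (wa′b)^{(N)}) (extP (wb′b)^{(N)})‖ ≤ CTW1(d,a)/N` —
regularised form `B5G183RateW1RankOne.rankOne_bw_eq` + `plant_rankOne`, then the trilinear split
`opNorm_rankOne_sub_rankOne_le` with the coefficient rate `B5G183Rate.cB_rate`, the size `cB_le`, and the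
vector facts above. [cite: Balaban1984PropagatorsI, (1.83) p.31, (1.86)/(1.88) p.32, Prop. 1.1 (1.89) p.33;
King1986, (4.19)–(4.20) p.672, (4.24) p.673] [folklore] -/
theorem opNorm_T_piece_le_of_adm (hN : 1 ≤ N) (hR : 1 ≤ R) (hRN : 1 ≤ R * N) (a : ℝ) (ha : 0 < a)
    {s : Fin d → ℝ} (hs : ∀ ν, |s ν| ≤ Real.pi) (hs0 : s ≠ 0) {ν ν' : Fin d}
    {wa wb : (Fin d → Fin (R * N)) → ℂ} {wa' wb' : (Fin d → Fin N) → ℂ}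
    (hwa : AdmW N R s ν wa wa') (hwb : AdmW N R s ν' wb wb') :
    ‖rankOne (balabanFiber (R * N) hRN a ha s hs hs0).cT
          ((balabanFiber (R * N) hRN a ha s hs hs0).bw wa) ((balabanFiber (R * N) hRN a ha s hs hs0).bw wb)
        - rankOne (balabanFiber N hN a ha s hs hs0).cT
          (extP R s ((balabanFiber N hN a ha s hs hs0).bw wa'))
          (extP R s ((balabanFiber N hN a ha s hs hs0).bw wb'))‖
      ≤ CTW1 d a / N := by
  obtain ⟨ν₀, hν₀⟩ : ∃ ν, s ν ≠ 0 := Function.ne_iff.mp hs0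
  have hN0 : (0 : ℝ) < N := by exact_mod_cast hN
  have hN1 : (1 : ℝ) ≤ N := by exact_mod_cast hN
  have hC := B5ActionRate166.Cphi_pos
  have hg := T4GaugeActionRate.gam0_pos d
  have hBsq := Bsq_nonneg d a
  have hBr := Brate_nonneg d a
  rw [← plant_rankOne, rankOne_bw_eq hRN a ha hs hs0, rankOne_bw_eq hN a ha hs hs0, plant_rankOne]
  -- coefficient facts
  have hcbR := cB_pos hRN a ha hs ν₀ hν₀
  have hcbN := cB_pos hN a ha hs ν₀ hν₀
  have hcle := cB_le hN a ha hs ν₀ hν₀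
  have hrate := cB_rate (N := N) (R := R) hN hR a ha hs ν₀ hν₀
  have hdiff : ‖((cB (R * N) a s : ℝ) : ℂ) - ((cB N a s : ℝ) : ℂ)‖
      ≤ 4 * d * B5ActionRate166.Cphi / T4GaugeActionRate.gam0 d ^ 2 / (N : ℝ) ^ 2 := by
    rw [← Complex.ofReal_sub, Complex.norm_real, Real.norm_eq_abs, abs_sub_comm]
    calc |cB N a s - cB (R * N) a s|
        ≤ 4 * d * B5ActionRate166.Cphi / T4GaugeActionRate.gam0 d ^ 2 * ((N : ℝ) ^ 2)⁻¹ := hrate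
      _ = _ := by ring
  have hnN : ‖((cB N a s : ℝ) : ℂ)‖ ≤ (4 * d + a) / a := by
    rw [Complex.norm_real, Real.norm_eq_abs, abs_of_pos hcbN]
    exact hcle.1.trans hcle.2
  -- vector facts
  set S := Real.sqrt (d * Bsq d a) with hS
  set Sr := Real.sqrt (d * Brate d a) with hSr
  have hS0 : 0 ≤ S := Real.sqrt_nonneg _
  have hSr0 : 0 ≤ Sr := Real.sqrt_nonneg _
  have hx := l2n_bRw_le_of_dom hRN a ha hs hs0 hwa.domR
  have hy := l2n_bRw_le_of_dom hRN a ha hs hs0 hwb.domR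
  have hx' := l2n_extP_bRw_le_of_dom (R := R) hN a ha hs hs0 hwa.domN
  have hdx := l2n_bRw_diff_le_of_adm hN hR hRN a ha hs hs0 hwa
  have hdy := l2n_bRw_diff_le_of_adm hN hR hRN a ha hs hs0 hwb
  have key := opNorm_rankOne_sub_rankOne_le ((cB (R * N) a s : ℝ) : ℂ) ((cB N a s : ℝ) : ℂ)
    (bRw (R * N) a s wa) (extP R s (bRw N a s wa')) (bRw (R * N) a s wb) (extP R s (bRw N a s wb'))
    (K₁ := 4 * d * B5ActionRate166.Cphi / T4GaugeActionRate.gam0 d ^ 2 / (N : ℝ) ^ 2 * (S * S))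
    (K₂ := (4 * d + a) / a * (Sr / N * S)) (K₃ := (4 * d + a) / a * (S * (Sr / N)))
    (by positivity) (by positivity) (by positivity)
    (mul_le_mul hdiff (mul_le_mul hx hy (l2n_nonneg _) hS0)
      (mul_nonneg (l2n_nonneg _) (l2n_nonneg _)) (by positivity))
    (mul_le_mul hnN (mul_le_mul hdx hy (l2n_nonneg _) (by positivity))
      (mul_nonneg (l2n_nonneg _) (l2n_nonneg _)) (by positivity))
    (mul_le_mul hnN (mul_le_mul hx' hdy (l2n_nonneg _) hS0)
      (mul_nonneg (l2n_nonneg _) (l2n_nonneg _)) (by positivity))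
  refine key.trans ?_
  have hSS : S * S = d * Bsq d a := Real.mul_self_sqrt (by positivity)
  rw [hSS]
  have h2 : 4 * d * B5ActionRate166.Cphi / T4GaugeActionRate.gam0 d ^ 2 / (N : ℝ) ^ 2 * (d * Bsq d a)
      ≤ 4 * d * B5ActionRate166.Cphi / T4GaugeActionRate.gam0 d ^ 2 / N * (d * Bsq d a) := by
    have : 4 * d * B5ActionRate166.Cphi / T4GaugeActionRate.gam0 d ^ 2 / (N : ℝ) ^ 2
        ≤ 4 * d * B5ActionRate166.Cphi / T4GaugeActionRate.gam0 d ^ 2 / N :=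
      div_le_div_of_nonneg_left (by positivity) hN0 (by nlinarith)
    exact mul_le_mul_of_nonneg_right this (by positivity)
  calc 4 * d * B5ActionRate166.Cphi / T4GaugeActionRate.gam0 d ^ 2 / (N : ℝ) ^ 2 * (d * Bsq d a)
        + (4 * d + a) / a * (Sr / N * S) + (4 * d + a) / a * (S * (Sr / N))
      ≤ 4 * d * B5ActionRate166.Cphi / T4GaugeActionRate.gam0 d ^ 2 / N * (d * Bsq d a)
        + (4 * d + a) / a * (Sr / N * S) + (4 * d + a) / a * (S * (Sr / N)) := by gcongr
    _ = CTW1 d a / N := by unfold CTW1; rw [hS, hSr]; ring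

end PieceT

/-! ## §6 The residual for admissible weights: diagonal piece plus `(CRW1 + 2CCW1 + CTW1)/N` [folklore] -/

section Residual

variable {N R : ℕ} [NeZero N] [NeZero R]

/-- the finite-rank constant `CRW1 + 2·CCW1 + CTW1` (so that `CW1op = CdgW1 +` this). [folklore] -/
def CfrW (d : ℕ) (a : ℝ) : ℝ := CRW1 d a + 2 * CCW1 d a + CTW1 d a

omit [NeZero N] [NeZero R] in
/-- `0 ≤ CfrW` for `0 < a`. [folklore] -/
theorem CfrW_nonneg (d : ℕ) {a : ℝ} (ha : 0 < a) : 0 ≤ CfrW d a := by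
  have h2 := CRW1_nonneg d ha.le
  have h3 := CCW1_nonneg d ha.le
  have h4 := CTW1_nonneg d ha
  unfold CfrW; positivity

omit [NeZero N] [NeZero R] in
/-- `CW1op = CdgW1 + CfrW`. [folklore] -/
theorem CW1op_eq (d : ℕ) (a : ℝ) : CW1op d a = CdgW1 d a + CfrW d a := by
  unfold CW1op CfrW; ring

/-- **THE PLANTED LEVEL DIFFERENCE FOR ADMISSIBLE WEIGHTS = DIAGONAL PIECE + `O(1/N)`:**
`‖D_{wa}F_{RN}D*_{wb} − plant_R(D_{wa′}F_N D*_{wb′})‖ ≤ ‖diag(F.dg wa wb) − diag(extP (F′.dg wa′ wb′))‖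
+ CfrW(d,a)/N` — `B5G183RatePieces.opNorm_residual_le_pieces` and §3–§5.  The whole EXPONENT question
of a weighted order-two residual therefore lives on the free diagonal. [cite: Balaban1984PropagatorsI,
(1.83) p.31, Prop. 1.1 (1.89) p.33; King1986, (4.19)–(4.20), (4.23) p.672] [folklore] -/
theorem residual_le_diag_add_of_adm (hN : 1 ≤ N) (hR : 1 ≤ R) (hRN : 1 ≤ R * N) (a : ℝ) (ha : 0 < a)
    {s : Fin d → ℝ} (hs : ∀ ν, |s ν| ≤ Real.pi) (hs0 : s ≠ 0) {ν ν' : Fin d}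
    {wa wb : (Fin d → Fin (R * N)) → ℂ} {wa' wb' : (Fin d → Fin N) → ℂ}
    (hwa : AdmW N R s ν wa wa') (hwb : AdmW N R s ν' wb wb') :
    let F := balabanFiber (R * N) hRN a ha s hs hs0
    let F' := balabanFiber N hN a ha s hs hs0
    ‖sandwich wa wb F.G - plant R s (sandwich wa' wb' F'.G)‖
      ≤ ‖Matrix.diagonal (F.dg wa wb) - Matrix.diagonal (extP R s (F'.dg wa' wb'))‖ + CfrW d a / N := by
  intro F F'
  have h0 := opNorm_residual_le_pieces (R := R) (N := N) (s := s) F F' wa wb wa' wb'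
  have h1 := opNorm_R_piece_le_of_adm hN hR hRN a ha hs hs0 hwa hwb
  have h2 := opNorm_C1_piece_le_of_adm hN hR hRN a ha hs hs0 hwa hwb
  have h3 := opNorm_C2_piece_le_of_adm hN hR hRN a ha hs hs0 hwa hwb
  have h4 := opNorm_T_piece_le_of_adm hN hR hRN a ha hs hs0 hwa hwb
  dsimp only at h0 h1 h2 h3 h4 ⊢
  have e : CfrW d a / (N : ℝ) = CRW1 d a / N + CCW1 d a / N + CCW1 d a / N + CTW1 d a / N := by
    unfold CfrW; ring
  rw [e]
  linarith

end Residual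

/-! ## §7 Instances: `∂`, `W∂`, and every real power `W^θ∂`, `θ ≥ 0` [folklore] -/

section Instances

variable {N R : ℕ} [NeZero N] [NeZero R]

omit [NeZero N] [NeZero R] in
/-- the centre class carries NO King weight: `Wc n 0 p′ = 1` (`jOf = 0`, empty product of (4.20)).
[cite: King1986, (4.20) p.672] [folklore] -/
theorem Wc_zero {n : ℕ} [NeZero n] (hn : 1 ≤ n) {s : Fin d → ℝ} (hs : ∀ ν, |s ν| ≤ Real.pi) :
    Wc n (0 : Fin d → Fin n) s = 1 := by
  unfold Wc
  rw [jOf_zero hn hs]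
  simp [aliasWeight]

omit [NeZero R] in
/-- at the centre `W^θ∂ = ∂` for every `θ`. [folklore] -/
theorem wθdSym_centre {n : ℕ} [NeZero n] (hn : 1 ≤ n) (θ : ℝ) {s : Fin d → ℝ}
    (hs : ∀ ν, |s ν| ≤ Real.pi) (ν : Fin d) :
    wθdSym n θ (0 : Fin d → Fin n) s ν = dSym n 0 s ν := by
  unfold wθdSym
  rw [Wc_zero hn hs, Real.one_rpow]
  push_cast
  ring

/-- the PAIRED difference of `W^θ∂` is the common weight times the difference of the derivatives:
`W^θ∂^{(RN)}(ιk) − W^θ∂^{(N)}(k) = (Wc N k)^θ·(∂^{(RN)}(ιk) − ∂^{(N)}(k))` (`B5G183RateO2Diag.Wc_iota`).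
[folklore] -/
theorem wθdSym_iota_sub (hN : 1 ≤ N) (θ : ℝ) (k : Fin d → Fin N) {s : Fin d → ℝ}
    (hs : ∀ ν, |s ν| ≤ Real.pi) (ν : Fin d) :
    wθdSym (R * N) θ (iota R k s) s ν - wθdSym N θ k s ν
      = ((Wc N k s ^ θ : ℝ) : ℂ) * (dSym (R * N) (iota R k s) s ν - dSym N k s ν) := by
  unfold wθdSym
  rw [Wc_iota hN k hs, mul_sub]

/-- **`W^θ∂_ν` IS ADMISSIBLE WEIGHT DATA for every `θ ≥ 0`** (`|W^θ∂| ≤ |∂|` by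
`B5G183RateWTheta.norm_wθdSym_le`; paired rate `(Wc)^θ·6‖q̃‖²/N ≤ 6‖q̃‖²/N` by `Wc_iota`,
`B5G183RateL2.dSym_rate_le`). [cite: King1986, (4.19)–(4.20) p.672, (4.29)–(4.31) p.673] [folklore] -/
theorem admW_wθ (hN : 1 ≤ N) (hR : 1 ≤ R) {θ : ℝ} (hθ : 0 ≤ θ) {s : Fin d → ℝ}
    (hs : ∀ ν, |s ν| ≤ Real.pi) (ν : Fin d) :
    AdmW N R s ν (fun K => wθdSym (R * N) θ K s ν) (fun k => wθdSym N θ k s ν) where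
  domR K := norm_wθdSym_le hθ K hs ν
  domN k := norm_wθdSym_le hθ k hs ν
  rate k := by
    have hW := Wc_nonneg_le_one (n := N) k hs
    have h1 : Wc N k s ^ θ ≤ 1 := Real.rpow_le_one hW.1 hW.2 hθ
    have h0 : 0 ≤ Wc N k s ^ θ := Real.rpow_nonneg hW.1 θ
    rw [wθdSym_iota_sub hN θ k hs ν, norm_mul, Complex.norm_real, Real.norm_eq_abs, abs_of_nonneg h0]
    calc Wc N k s ^ θ * ‖dSym (R * N) (iota R k s) s ν - dSym N k s ν‖
        ≤ 1 * (6 * ‖symmAlias N k s‖ ^ 2 / N) :=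
          mul_le_mul h1 (B5G183RateL2.dSym_rate_le hN hR k hs ν) (norm_nonneg _) zero_le_one
      _ = 6 * ‖symmAlias N k s‖ ^ 2 / N := one_mul _

/-- `W∂_ν` (`θ = 1`) is admissible. [folklore] -/
theorem admW_w1 (hN : 1 ≤ N) (hR : 1 ≤ R) {s : Fin d → ℝ} (hs : ∀ ν, |s ν| ≤ Real.pi) (ν : Fin d) :
    AdmW N R s ν (fun K => w1dSym (R * N) K s ν) (fun k => w1dSym N k s ν) := by
  have h := admW_wθ (N := N) (R := R) hN hR zero_le_one hs ν
  simp only [wθdSym_one] at h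
  exact h

/-- `∂_ν` (`θ = 0`) is admissible. [folklore] -/
theorem admW_dSym (hN : 1 ≤ N) (hR : 1 ≤ R) {s : Fin d → ℝ} (hs : ∀ ν, |s ν| ≤ Real.pi) (ν : Fin d) :
    AdmW N R s ν (fun K => dSym (R * N) K s ν) (fun k => dSym N k s ν) := by
  have h := admW_wθ (N := N) (R := R) hN hR le_rfl hs ν
  simp only [wθdSym_zero] at h
  exact h

/-- **THE EXPONENT TRADE LIVES ON THE FREE DIAGONAL:** for every `θ ≥ 0` the `W^θ∂ ⊗ W^θ∂` residual of
`B5G183RateWTheta` is `≤ ‖diagonal piece‖ + CfrW(d,a)/N`. [cite: Balaban1984PropagatorsI, Prop. 1.1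
(1.89) p.33; King1986, (4.19)–(4.20), (4.23) p.672] [folklore] -/
theorem residualWθ_le_diag_add (hN : 1 ≤ N) (hR : 1 ≤ R) (hRN : 1 ≤ R * N) (a : ℝ) (ha : 0 < a)
    {θ : ℝ} (hθ : 0 ≤ θ) {s : Fin d → ℝ} (hs : ∀ ν, |s ν| ≤ Real.pi) (hs0 : s ≠ 0) (ν ν' : Fin d) :
    let F := balabanFiber (R * N) hRN a ha s hs hs0
    let F' := balabanFiber N hN a ha s hs hs0
    let wa : (Fin d → Fin (R * N)) → ℂ := fun K => wθdSym (R * N) θ K s ν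
    let wb : (Fin d → Fin (R * N)) → ℂ := fun K => wθdSym (R * N) θ K s ν'
    let wa' : (Fin d → Fin N) → ℂ := fun k => wθdSym N θ k s ν
    let wb' : (Fin d → Fin N) → ℂ := fun k => wθdSym N θ k s ν'
    ‖sandwich wa wb F.G - plant R s (sandwich wa' wb' F'.G)‖
      ≤ ‖Matrix.diagonal (F.dg wa wb) - Matrix.diagonal (extP R s (F'.dg wa' wb'))‖ + CfrW d a / N :=
  residual_le_diag_add_of_adm hN hR hRN a ha hs hs0 (admW_wθ hN hR hθ hs ν) (admW_wθ hN hR hθ hs ν')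

end Instances

end Literature.MathematicalPhysics.QuantumFieldTheory.Balaban1983to89.B5G183RateWgtPieces
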